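import Literature.Computability.Complexity.ResourceBoundedMeasure
import Literature.Computability.Complexity.RatBricks
import HarnessLib

/-!
# Resource-bounded measure: closure properties needing machines (finite unions, the empty class)

Sibling file of `ResourceBoundedMeasure.lean` holding the API of Lutz's `p`-measure that needs TM2
machine constructions, assembled from the `FP` brick algebra (`RatBricks`, `ZIntBricks`,
`IntPairBricks`) so that no machine is programmed here:

* `ratSME q = ⟨[q < 0] · bin |num q|, bin (den q)⟩` — the rational code of `IsPComputable`
  (`Encoding.pairBool encodingIntBool encodingNatBool` on `(q.num, q.den)`), and the conversion
  `Brick.toSMF` from difference pairs back to this sign–magnitude format;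
* `Brick.qaddSMF` — exact addition of two such codes, `⟨ratSME q₁, ratSME q₂⟩ ↦ ratSME (q₁ + q₂)`
  (cross-multiply with `zmulF`/`zaddF`, multiply denominators with `prodFn`, reduce to lowest terms
  with `qnormF`), in `FP`;
* `isPComputable_const`, `IsPComputable.add`; hence `pMeasureZero_empty` (the constant martingale)
  and the **finite unions property** `PMeasureZero.union` (van Melkebeek §2.5.3: play both
  strategies side by side, `d₁ + d₂`), `pMeasureZero_biUnion_finset`; and the consequences
  `PMeasureZero.not_pMeasureOneInE` (small and large are exclusive, GIVEN `¬ PMeasureZero E` —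
  measure conservation itself is a machine construction not done here) and
  `PMeasureZero.exists_not_mem` (existence by measure).

Not here: the E-uniform union lemma (Thm. 2.5.2), measure conservation `¬ PMeasureZero E`,
`PMeasureZero P` — statement items PSmall / ENotSmall / ZeroOneLawBPP of route
QuantumAdvantage/MeasureZeroOne carry them.

## References

* [VanMelkebeek2000] D. van Melkebeek, *Randomness and Completeness in Computational Complexity*,
  LNCS 1950 (2000), §2.5.3 ("monotone and closed under union (finite unions property)").
* [Lutz1992] J. H. Lutz, *Almost everywhere high nonuniform complexity*, JCSS 44 (1992), Lemma 3.10.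
-/

namespace Literature.Computability.Complexity

open _root_.Computability Brick


/-! ### The rational code of `IsPComputable` and its arithmetic in `FP` -/

/-- `ratSME q`: the code of a rational used by `IsPComputable` — the lowest-terms numerator in the
sign–magnitude format of `encodingIntBool` paired with the binary denominator,
`(encodingIntBool.pairBool encodingNatBool).encode (q.num, q.den)`. [folklore] -/
def ratSME (q : ℚ) : List Bool := (encodingIntBool.pairBool encodingNatBool).encode (q.num, q.den)

/-- `ratSME q = ⟨encodingIntBool.encode q.num, bin q.den⟩`. [folklore] -/
theorem ratSME_eq (q : ℚ) : ratSME q = boolPair (encodingIntBool.encode q.num) (encodeNat q.den) := rfl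

/-- The sign–magnitude code of an integer, written out. [folklore] -/
theorem encodingIntBool_encode_eq (z : ℤ) :
    encodingIntBool.encode z = boolPair [decide (z < 0)] (encodeNat z.natAbs) := rfl

/-- `IsPComputable d` says exactly that `w ↦ ratSME (d w)` is in `FP`. [folklore] -/
theorem isPComputable_iff_comp_mem_FP {d : List Bool → ℚ} :
    IsPComputable d ↔ (fun w => ratSME (d w)) ∈ FP :=
  Iff.rfl

namespace Brick

/-- **From a difference pair back to sign–magnitude**: `toSMF w = encodingIntBool.encode (ival w)`
(sign bit `[0 < -ival w]` by `iposFn ∘ zswapF`, magnitude by `zmagF`). [folklore] -/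
noncomputable def toSMF : List Bool → List Bool := fanoutFn (iposFn ∘ zswapF) zmagF

/-- Value of `toSMF`. [folklore] -/
@[simp] theorem toSMF_apply (w : List Bool) : toSMF w = encodingIntBool.encode (ival w) := by
  rw [toSMF, fanoutFn_apply, Function.comp_apply, iposFn_apply, ival_zswapF, zmagF_apply,
    encodingIntBool_encode_eq, decide_eq_decide.2 neg_pos]

/-- `toSMF ∈ FP`. [cite: AroraBarak2009, §1.3] -/
theorem toSMF_mem_FP : toSMF ∈ FP :=
  fanoutFn_mem_FP (comp_mem_FP iposFn_mem_FP zswapF_mem_FP) zmagF_mem_FP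

/-- The unreduced numerator `num₁ · den₂ + num₂ · den₁` of a sum of two sign–magnitude rational
codes, as a difference pair. [cite: KnuthTAOCP2, §4.5.1] -/
noncomputable def qaddNumF : List Bool → List Bool :=
  zaddF ∘ fanoutFn (zmulF ∘ fanoutFn (ofSMFn ∘ fstF ∘ fstF) (natZF ∘ sndF ∘ sndF))
    (zmulF ∘ fanoutFn (ofSMFn ∘ fstF ∘ sndF) (natZF ∘ sndF ∘ fstF))

/-- `qaddNumF ∈ FP`. [cite: AroraBarak2009, §1.3] -/
theorem qaddNumF_mem_FP : qaddNumF ∈ FP :=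
  comp_mem_FP zaddF_mem_FP (fanoutFn_mem_FP
    (comp_mem_FP zmulF_mem_FP (fanoutFn_mem_FP (comp_mem_FP ofSMFn_mem_FP (comp_mem_FP fstF_mem_FP fstF_mem_FP))
      (comp_mem_FP natZF_mem_FP (comp_mem_FP sndF_mem_FP sndF_mem_FP))))
    (comp_mem_FP zmulF_mem_FP (fanoutFn_mem_FP (comp_mem_FP ofSMFn_mem_FP (comp_mem_FP fstF_mem_FP sndF_mem_FP))
      (comp_mem_FP natZF_mem_FP (comp_mem_FP sndF_mem_FP fstF_mem_FP)))))

/-- Value of `qaddNumF` on a pair of rational codes. [folklore] -/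
theorem qaddNumF_apply (q₁ q₂ : ℚ) :
    qaddNumF (boolPair (ratSME q₁) (ratSME q₂)) = dpEnc (q₁.num * q₂.den + q₂.num * q₁.den) := by
  simp [qaddNumF, ratSME_eq]

/-- **Exact addition of sign–magnitude rational codes**: cross-multiply, multiply the denominators,
reduce to lowest terms (`qnormF`), convert the numerator back to sign–magnitude.
[cite: KnuthTAOCP2, §4.5.1] -/
noncomputable def qaddSMF : List Bool → List Bool :=
  fanoutFn (toSMF ∘ fstF) sndF ∘ qnormF ∘
    fanoutFn qaddNumF (prodFn ∘ fanoutFn (sndF ∘ fstF) (sndF ∘ sndF))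

/-- `qaddSMF ∈ FP`. [cite: AroraBarak2009, §1.3] -/
theorem qaddSMF_mem_FP : qaddSMF ∈ FP :=
  comp_mem_FP (fanoutFn_mem_FP (comp_mem_FP toSMF_mem_FP fstF_mem_FP) sndF_mem_FP)
    (comp_mem_FP qnormF_mem_FP (fanoutFn_mem_FP qaddNumF_mem_FP
      (comp_mem_FP prodFn_mem_FP (fanoutFn_mem_FP (comp_mem_FP sndF_mem_FP fstF_mem_FP)
        (comp_mem_FP sndF_mem_FP sndF_mem_FP)))))

/-- The sum of two rationals from numerators and denominators. [folklore] -/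
theorem intCast_div_natCast_eq_add (q₁ q₂ : ℚ) :
    ((q₁.num * q₂.den + q₂.num * q₁.den : ℤ) : ℚ) / ((q₁.den * q₂.den : ℕ) : ℚ) = q₁ + q₂ := by
  have h1 : (q₁.den : ℚ) ≠ 0 := Nat.cast_ne_zero.2 q₁.den_nz
  have h2 : (q₂.den : ℚ) ≠ 0 := Nat.cast_ne_zero.2 q₂.den_nz
  conv_rhs => rw [← Rat.num_div_den q₁, ← Rat.num_div_den q₂, div_add_div _ _ h1 h2]
  push_cast
  ring

/-- **`qaddSMF ⟨ratSME q₁, ratSME q₂⟩ = ratSME (q₁ + q₂)`.** [cite: KnuthTAOCP2, §4.5.1] -/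
theorem qaddSMF_apply (q₁ q₂ : ℚ) :
    qaddSMF (boolPair (ratSME q₁) (ratSME q₂)) = ratSME (q₁ + q₂) := by
  have hden : 0 < q₁.den * q₂.den := Nat.mul_pos q₁.den_pos q₂.den_pos
  have hprod : (prodFn ∘ fanoutFn (sndF ∘ fstF) (sndF ∘ sndF)) (boolPair (ratSME q₁) (ratSME q₂)) =
      encodeNat (q₁.den * q₂.den) := by
    simp [ratSME_eq]
  rw [qaddSMF, Function.comp_apply, Function.comp_apply, fanoutFn_apply qaddNumF, qaddNumF_apply,
    hprod, qnormF_dpEnc _ hden, intCast_div_natCast_eq_add, qEnc, fanoutFn_apply,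
    Function.comp_apply, fstF_boolPair, sndF_boolPair, toSMF_apply, ival_dpEnc, ratSME_eq]

end Brick

/-! ### `p`-computable martingales are closed under sums; finite unions -/

/-- A constant is `p`-computable (constant-output transducer). [folklore] -/
theorem isPComputable_const (c : ℚ) : IsPComputable fun _ => c :=
  const_mem_FP (ratSME c)

/-- **The sum of two `p`-computable functions is `p`-computable** (fan out, add the codes exactly
with `Brick.qaddSMF`). [cite: VanMelkebeek2000, §2.5.3 (finite unions property)] -/
theorem IsPComputable.add {d₁ d₂ : List Bool → ℚ} (h₁ : IsPComputable d₁) (h₂ : IsPComputable d₂) :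
    IsPComputable (d₁ + d₂) := by
  rw [isPComputable_iff_comp_mem_FP] at h₁ h₂ ⊢
  have h := comp_mem_FP Brick.qaddSMF_mem_FP (fanoutFn_mem_FP h₁ h₂)
  refine (congrArg (· ∈ FP) (funext fun w => ?_)).mp h
  rw [Function.comp_apply, fanoutFn_apply, Brick.qaddSMF_apply, Pi.add_apply]

/-- **The empty class is `p`-null** (the constant martingale `1`): the computability clause of
`PMeasureZero` is satisfiable. [cite: VanMelkebeek2000, §2.5.3] -/
theorem pMeasureZero_empty : PMeasureZero (∅ : Set (Language Bool)) :=
  ⟨fun _ => 1, fun _ => zero_le_one, fun _ => by ring, isPComputable_const 1,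
    fun _ h => absurd h (Set.notMem_empty _)⟩

/-- **Finite unions property**: the union of two `p`-null classes is `p`-null — `d₁ + d₂` is a
`p`-computable martingale succeeding wherever `d₁` or `d₂` does.
[cite: VanMelkebeek2000, §2.5.3 (finite unions property)] -/
theorem PMeasureZero.union {X Y : Set (Language Bool)} (hX : PMeasureZero X) (hY : PMeasureZero Y) :
    PMeasureZero (X ∪ Y) := by
  rw [pMeasureZero_iff] at hX hY ⊢
  obtain ⟨d₁, hm₁, hc₁, hs₁⟩ := hX
  obtain ⟨d₂, hm₂, hc₂, hs₂⟩ := hY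
  refine ⟨d₁ + d₂, hm₁.add hm₂, hc₁.add hc₂, ?_⟩
  rintro L (hL | hL)
  · exact SucceedsOn.add_right (hs₁ hL) hm₂.1
  · rw [add_comm]; exact SucceedsOn.add_right (hs₂ hL) hm₁.1

/-- Finite unions, indexed form: a finite union of `p`-null classes is `p`-null.
[cite: VanMelkebeek2000, §2.5.3 (finite unions property)] -/
theorem pMeasureZero_biUnion_finset {ι : Type} (s : Finset ι) {X : ι → Set (Language Bool)}
    (h : ∀ i ∈ s, PMeasureZero (X i)) : PMeasureZero (⋃ i ∈ s, X i) := by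
  classical
  induction s using Finset.induction_on with
  | empty => simpa using pMeasureZero_empty
  | insert a s ha ih =>
    rw [Finset.set_biUnion_insert]
    exact (h a (Finset.mem_insert_self a s)).union (ih fun i hi => h i (Finset.mem_insert_of_mem hi))

/-- **A `p`-null class cannot also have measure one in `E`, provided `E` itself is not `p`-null**
("a subset of `E` cannot be small and large at the same time, since this would imply
`μ_E(E) = 0`"; the proviso is measure conservation, §2.5.3, taken here as a hypothesis).
[cite: VanMelkebeek2000, §2.5.3] -/
theorem PMeasureZero.not_pMeasureOneInE (hE : ¬ PMeasureZero E) {X : Set (Language Bool)}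
    (hX : PMeasureZero X) : ¬ PMeasureOneInE X := fun h1 =>
  hE ((hX.union h1).mono fun L hL => (em (L ∈ X)).elim Or.inl fun hLX => Or.inr ⟨hL, hLX⟩)

/-- **Existence by measure**: a `p`-null class omits some language (indeed some language of every
class that is not `p`-null, by monotonicity). [cite: Lutz1992, §3 (s1)–(s3)] -/
theorem PMeasureZero.exists_not_mem {X : Set (Language Bool)} (hX : PMeasureZero X) :
    ∃ L : Language Bool, L ∉ X := by
  by_contra h
  exact not_pMeasureZero_univ (hX.mono fun L _ => not_exists_not.1 h L)

end Literature.Computability.Complexity
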